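import Summits.Ventures.Crystal3D.Theorems.StickyWulffConstantCoaxialWallLawTwoLatticeTwinReading
import Summits.Ventures.Crystal3D.Theorems.StickyWulffConstantCoaxialWallLawTwinFrames
import Summits.Ventures.Crystal3D.Theorems.StickyWulffConstantCoaxialWallLawTriadicLattice
import Summits.Ventures.Crystal3D.Theorems.StickyWulffConstantCoaxialWallLawChainCyclic
import Summits.Ventures.Crystal3D.Theorems.StickyWulffConstantCoaxialWallLawWordRigidity
import Summits.Ventures.Crystal3D.Theorems.StickyWulffConstantGenericWallFloorCapperRiseSharp
import HarnessLib

/-!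
# Readings in a two-lattice configuration II: the TWIN plate system forces `m = ±K`
# (crux `CoaxialWallLaw`, stmt-Ventures-19481, line `WallLedgerF`; interpretation completeness, part 2)

HONEST FRAMING. Venture `Summits/Ventures/Crystal3D` (cell `crystal3d-full`), helper `--supports` the crux
`CoaxialWallLaw` of `route-Ventures-StickyWulffConstant` (REGISTERED line `WallLedgerF`).  Rung credit; F-C1 not
moved; no census, no kissing facts, pure lattice geometry.  cf-p1 g28 §86(79)/(86) item (3) (19481-p2 g7), on top of
`…TwoLatticeReadings`:

* **TWIN PLATES** (`Λ₁ = L·Λ₀ + s₁`, `Λ₂ = (H∘L)·Λ₀ + s₂`, `H` the half-turn about the model axis `e₃`, twin plane normal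
  `K = L e₃` — the frame family of `EndRowTwinHalfTurn`): **`twin_reading_twinPlates`** — a TWIN `(G, m)` reading at a
  ball of `X ⊆ Λ₁ ∪ Λ₂` has `m = ±K` and `G·slots ∈ {L·slots, (H∘L)·slots}`.  Mechanism: the edges of the lower face are
  unit vectors of BOTH lattices (`unit_orth_axis_of_both`: a common unit vector of `L·Λ₀` and `(H∘L)·Λ₀` is `⊥ K`,
  since the half-turn of a non-basal slot is not a slot), so the three lower cappers have equal `K`-components and
  `sum_sq_inner_cappers` gives `⟪m, K⟫² = 1`; the frame alternative `(M_m∘G)·slots = L_a·slots` becomes the other plate's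
  frame because `M_{±K} ∘ L` and `H ∘ L` have the same slot dozen (`twinFrame_neg_eq`).
* The TRANSLATION plate system (`EndRowTrans`) is part 2b (`…TwoLatticeTransPlates`); FULL readings:
  `full_reading_twoLattice` (part 1) already gives `G·slots ∈ {L₁·slots, L₂·slots}`.  Part 3 (`…TwoLatticeAdm`) turns
  these into «only ROOT classes of the plate systems carry end pairs».
WHAT THIS IS NOT: not the row, not the certificate; F-C1 not moved.
-/

noncomputable section

namespace Summit.Ventures.Crystal3D.Theorems

open Summit.Ventures.Crystal3D Finset
open Literature.MathematicalPhysics.StatisticalMechanics (fccStacking)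
open scoped InnerProductSpace

/-! ### Small tools -/

/-- Menu normals transfer along equal slot dozens. -/
theorem menu_of_image_fccSlots_eq {G L : EuclideanSpace ℝ (Fin 3) ≃ₗᵢ[ℝ] EuclideanSpace ℝ (Fin 3)}
    (h : (G : EuclideanSpace ℝ (Fin 3) → EuclideanSpace ℝ (Fin 3)) '' ↑fccSlots =
      (L : EuclideanSpace ℝ (Fin 3) → EuclideanSpace ℝ (Fin 3)) '' ↑fccSlots)
    {m : EuclideanSpace ℝ (Fin 3)}
    (hmenu : ∀ w ∈ fccSlots, ⟪L w, m⟫_ℝ = 0 ∨ ⟪L w, m⟫_ℝ = Real.sqrt (2 / 3) ∨ ⟪L w, m⟫_ℝ = -Real.sqrt (2 / 3)) :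
    ∀ w ∈ fccSlots, ⟪G w, m⟫_ℝ = 0 ∨ ⟪G w, m⟫_ℝ = Real.sqrt (2 / 3) ∨ ⟪G w, m⟫_ℝ = -Real.sqrt (2 / 3) := by
  intro w hw
  have : G w ∈ (L : EuclideanSpace ℝ (Fin 3) → EuclideanSpace ℝ (Fin 3)) '' ↑fccSlots := h ▸ ⟨w, Finset.mem_coe.2 hw, rfl⟩
  obtain ⟨w', hw', hww'⟩ := this
  rw [← hww']; exact hmenu w' (Finset.mem_coe.1 hw')

/-- Registered slots transfer along equal slot dozens: if `G·slots = L·slots` then every `G w` is an `L`-lattice vector. -/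
theorem symm_map_mem_of_image_fccSlots_eq {G L : EuclideanSpace ℝ (Fin 3) ≃ₗᵢ[ℝ] EuclideanSpace ℝ (Fin 3)}
    (h : (G : EuclideanSpace ℝ (Fin 3) → EuclideanSpace ℝ (Fin 3)) '' ↑fccSlots =
      (L : EuclideanSpace ℝ (Fin 3) → EuclideanSpace ℝ (Fin 3)) '' ↑fccSlots)
    {w : EuclideanSpace ℝ (Fin 3)} (hw : w ∈ fccSlots) : L.symm (G w) ∈ fccStacking 1 (Real.sqrt (2 / 3)) := by
  have : G w ∈ (L : EuclideanSpace ℝ (Fin 3) → EuclideanSpace ℝ (Fin 3)) '' ↑fccSlots := h ▸ ⟨w, Finset.mem_coe.2 hw, rfl⟩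
  obtain ⟨w', hw', hww'⟩ := this
  rw [← hww', LinearIsometryEquiv.symm_apply_apply]
  exact mem_fcc_of_mem_fccSlots (Finset.mem_coe.1 hw')

/-- `√6 · m` is an `L`-lattice vector for a menu normal `m` of `L`. -/
theorem symm_sqrt6_menu_mem (L : EuclideanSpace ℝ (Fin 3) ≃ₗᵢ[ℝ] EuclideanSpace ℝ (Fin 3)) {m : EuclideanSpace ℝ (Fin 3)}
    (hmenu : ∀ w ∈ fccSlots, ⟪L w, m⟫_ℝ = 0 ∨ ⟪L w, m⟫_ℝ = Real.sqrt (2 / 3) ∨ ⟪L w, m⟫_ℝ = -Real.sqrt (2 / 3)) :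
    L.symm ((3 : ℝ) • (Real.sqrt (2 / 3) • m)) ∈ fccStacking 1 (Real.sqrt (2 / 3)) := by
  obtain ⟨y, hy, hLy⟩ := exists_lattice_eq_sqrt6_menu L hmenu
  have e : (3 : ℝ) • (Real.sqrt (2 / 3) • m) = L y := by rw [hLy, smul_smul, three_mul_sqrt_twoThirds]
  rw [e, LinearIsometryEquiv.symm_apply_apply]; exact hy

/-- From `Σ ⟪c_k, z⟫² = (1 + 3⟪n, z⟫²)/2` with three EQUAL menu-valued components: `⟪n, z⟫ = ±1`, i.e. `n = ±z`. -/
theorem eq_or_eq_neg_of_cappers_level {c₁ c₂ c₃ n z : EuclideanSpace ℝ (Fin 3)}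
    (h₁ : ‖c₁‖ = 1) (h₂ : ‖c₂‖ = 1) (h₃ : ‖c₃‖ = 1) (hn : ‖n‖ = 1) (hz : ‖z‖ = 1)
    (h₁₂ : ⟪c₁, c₂⟫_ℝ = 1 / 2) (h₁₃ : ⟪c₁, c₃⟫_ℝ = 1 / 2) (h₂₃ : ⟪c₂, c₃⟫_ℝ = 1 / 2)
    (hn₁ : ⟪c₁, n⟫_ℝ = Real.sqrt (2 / 3)) (hn₂ : ⟪c₂, n⟫_ℝ = Real.sqrt (2 / 3)) (hn₃ : ⟪c₃, n⟫_ℝ = Real.sqrt (2 / 3))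
    {τ : ℝ} (hτ : τ = 0 ∨ τ = Real.sqrt (2 / 3) ∨ τ = -Real.sqrt (2 / 3))
    (e₁ : ⟪c₁, z⟫_ℝ = τ) (e₂ : ⟪c₂, z⟫_ℝ = τ) (e₃ : ⟪c₃, z⟫_ℝ = τ) : z = n ∨ z = -n := by
  have key := sum_sq_inner_cappers h₁ h₂ h₃ hn hz h₁₂ h₁₃ h₂₃ hn₁ hn₂ hn₃
  rw [e₁, e₂, e₃] at key
  have h23 : Real.sqrt (2 / 3) ^ 2 = 2 / 3 := Real.sq_sqrt (by norm_num)
  have hsq : ⟪n, z⟫_ℝ ^ 2 = 1 := by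
    rcases hτ with rfl | rfl | rfl
    · nlinarith [sq_nonneg ⟪n, z⟫_ℝ]
    · nlinarith [h23]
    · rw [neg_sq] at key; nlinarith [h23]
  have hprod : (⟪n, z⟫_ℝ - 1) * (⟪n, z⟫_ℝ + 1) = 0 := by nlinarith [hsq]
  rcases mul_eq_zero.1 hprod with h | h
  · exact Or.inl ((inner_eq_one_iff_of_norm_eq_one (𝕜 := ℝ) hn hz).1 (by linarith)).symm
  · exact Or.inr (eq_neg_of_inner_eq_neg_one' hn hz (by linarith))

/-! ### The twin plate system -/

section TwinPlates

variable (L : EuclideanSpace ℝ (Fin 3) ≃ₗᵢ[ℝ] EuclideanSpace ℝ (Fin 3))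

/-- **A common unit vector of `L·Λ₀` and `(H∘L)·Λ₀` lies in the twin plane** (`⊥ K = L e₃`). -/
theorem unit_orth_axis_of_both {v : EuclideanSpace ℝ (Fin 3)} (hv : ‖v‖ = 1)
    (h₁ : L.symm v ∈ fccStacking 1 (Real.sqrt (2 / 3)))
    (h₂ : (((ℝ ∙ EuclideanSpace.single (2 : Fin 3) (1 : ℝ)).reflection).trans L).symm v ∈ fccStacking 1 (Real.sqrt (2 / 3))) :
    ⟪v, L (EuclideanSpace.single (2 : Fin 3) (1 : ℝ))⟫_ℝ = 0 := by
  set w := L.symm v with hw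
  have hw1 : ‖w‖ = 1 := by rw [hw, LinearIsometryEquiv.norm_map, hv]
  have hws : w ∈ fccSlots := mem_fccSlots_of_unit h₁ hw1
  have hHw : (ℝ ∙ EuclideanSpace.single (2 : Fin 3) (1 : ℝ)).reflection w ∈ fccStacking 1 (Real.sqrt (2 / 3)) := by
    have : (((ℝ ∙ EuclideanSpace.single (2 : Fin 3) (1 : ℝ)).reflection).trans L).symm v =
        (ℝ ∙ EuclideanSpace.single (2 : Fin 3) (1 : ℝ)).reflection w := by
      rw [LinearIsometryEquiv.symm_trans, LinearIsometryEquiv.trans_apply, ← hw, Submodule.reflection_symm]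
    rw [this] at h₂; exact h₂
  have hHws : (ℝ ∙ EuclideanSpace.single (2 : Fin 3) (1 : ℝ)).reflection w ∈ fccSlots :=
    mem_fccSlots_of_unit hHw (by rw [LinearIsometryEquiv.norm_map, hw1])
  have hw2 : w 2 = 0 := by
    by_contra hne
    exact halfTurn_notMem_fccSlots hws hne hHws
  have : v = L w := by rw [hw, LinearIsometryEquiv.apply_symm_apply]
  rw [this, inner_frame_axis, hw2]

/-- The menu property of the axis `K = L e₃` for `L` and for `H∘L`. -/
theorem menu_axis_frame :
    ∀ w ∈ fccSlots, ⟪L w, L (EuclideanSpace.single (2 : Fin 3) (1 : ℝ))⟫_ℝ = 0 ∨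
      ⟪L w, L (EuclideanSpace.single (2 : Fin 3) (1 : ℝ))⟫_ℝ = Real.sqrt (2 / 3) ∨
      ⟪L w, L (EuclideanSpace.single (2 : Fin 3) (1 : ℝ))⟫_ℝ = -Real.sqrt (2 / 3) := by
  intro w hw; rw [inner_frame_axis]; exact slot_apply_two_cases hw

/-- See `menu_axis_frame`. -/
theorem menu_axis_twinFrame :
    ∀ w ∈ fccSlots, ⟪(((ℝ ∙ EuclideanSpace.single (2 : Fin 3) (1 : ℝ)).reflection).trans L) w,
        L (EuclideanSpace.single (2 : Fin 3) (1 : ℝ))⟫_ℝ = 0 ∨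
      ⟪(((ℝ ∙ EuclideanSpace.single (2 : Fin 3) (1 : ℝ)).reflection).trans L) w,
        L (EuclideanSpace.single (2 : Fin 3) (1 : ℝ))⟫_ℝ = Real.sqrt (2 / 3) ∨
      ⟪(((ℝ ∙ EuclideanSpace.single (2 : Fin 3) (1 : ℝ)).reflection).trans L) w,
        L (EuclideanSpace.single (2 : Fin 3) (1 : ℝ))⟫_ℝ = -Real.sqrt (2 / 3) := by
  intro w hw; rw [inner_twinFrame_axis]; exact slot_apply_two_cases hw

/-- **The basal mirror of `L` has the slot dozen of `H∘L`**, for `m = ±L e₃`: three registered face slots suffice, so we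
state it as: every `M_m (L w)` is an `(H∘L)`-lattice vector and vice versa. -/
theorem symm_twinFrame_reflect_frame {m : EuclideanSpace ℝ (Fin 3)}
    (hmK : m = L (EuclideanSpace.single (2 : Fin 3) (1 : ℝ)) ∨ m = -L (EuclideanSpace.single (2 : Fin 3) (1 : ℝ)))
    (hm : ‖m‖ = 1) {w : EuclideanSpace ℝ (Fin 3)} (hw : w ∈ fccSlots) :
    (((ℝ ∙ EuclideanSpace.single (2 : Fin 3) (1 : ℝ)).reflection).trans L).symm ((ℝ ∙ m)ᗮ.reflection (L w)) ∈
      fccStacking 1 (Real.sqrt (2 / 3)) := by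
  have e : (ℝ ∙ m)ᗮ.reflection (L w) = (((ℝ ∙ EuclideanSpace.single (2 : Fin 3) (1 : ℝ)).reflection).trans L) (-w) := by
    rw [reflection_unit_apply hm, twinFrame_neg_eq L hmK]
  rw [e, LinearIsometryEquiv.symm_apply_apply]
  exact fcc_neg_mem (mem_fcc_of_mem_fccSlots hw)

/-- Companion of `symm_twinFrame_reflect_frame`: every `M_m ((H∘L) w)` is an `L`-lattice vector. -/
theorem symm_frame_reflect_twinFrame {m : EuclideanSpace ℝ (Fin 3)}
    (hmK : m = L (EuclideanSpace.single (2 : Fin 3) (1 : ℝ)) ∨ m = -L (EuclideanSpace.single (2 : Fin 3) (1 : ℝ)))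
    (hm : ‖m‖ = 1) {w : EuclideanSpace ℝ (Fin 3)} (hw : w ∈ fccSlots) :
    L.symm ((ℝ ∙ m)ᗮ.reflection ((((ℝ ∙ EuclideanSpace.single (2 : Fin 3) (1 : ℝ)).reflection).trans L) w)) ∈
      fccStacking 1 (Real.sqrt (2 / 3)) := by
  have e : (ℝ ∙ m)ᗮ.reflection ((((ℝ ∙ EuclideanSpace.single (2 : Fin 3) (1 : ℝ)).reflection).trans L) w) = L (-w) := by
    rw [reflection_unit_apply hm, frame_neg_eq L hmK]
  rw [e, LinearIsometryEquiv.symm_apply_apply]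
  exact fcc_neg_mem (mem_fcc_of_mem_fccSlots hw)

variable {X : Finset (EuclideanSpace ℝ (Fin 3))}

/-- **TWIN readings in the twin plate system: `m = ±K` and the frame is one of the two plate frames.**  See the module
docstring. -/
theorem twin_reading_twinPlates (s₁ s₂ : EuclideanSpace ℝ (Fin 3))
    (hX : ∀ x ∈ X, x ∈ (fun p => L p + s₁) '' fccStacking 1 (Real.sqrt (2 / 3)) ∨
      x ∈ (fun p => (((ℝ ∙ EuclideanSpace.single (2 : Fin 3) (1 : ℝ)).reflection).trans L) p + s₂) ''
        fccStacking 1 (Real.sqrt (2 / 3)))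
    (G : EuclideanSpace ℝ (Fin 3) ≃ₗᵢ[ℝ] EuclideanSpace ℝ (Fin 3)) {m : EuclideanSpace ℝ (Fin 3)} (hm : ‖m‖ = 1)
    (hmenu : ∀ w ∈ fccSlots, ⟪G w, m⟫_ℝ = 0 ∨ ⟪G w, m⟫_ℝ = Real.sqrt (2 / 3) ∨ ⟪G w, m⟫_ℝ = -Real.sqrt (2 / 3))
    {q : EuclideanSpace ℝ (Fin 3)} (hq : q ∈ X)
    (hown : ∀ w ∈ fccSlots, ⟪G w, m⟫_ℝ < 0 → q + G w ∈ X)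
    (hmir : ∀ w ∈ fccSlots, ⟪G w, m⟫_ℝ < 0 → q + (G w - (2 * ⟪G w, m⟫_ℝ) • m) ∈ X) :
    (m = L (EuclideanSpace.single (2 : Fin 3) (1 : ℝ)) ∨ m = -L (EuclideanSpace.single (2 : Fin 3) (1 : ℝ))) ∧
    ((G : EuclideanSpace ℝ (Fin 3) → EuclideanSpace ℝ (Fin 3)) '' ↑fccSlots =
        (L : EuclideanSpace ℝ (Fin 3) → EuclideanSpace ℝ (Fin 3)) '' ↑fccSlots ∨
      (G : EuclideanSpace ℝ (Fin 3) → EuclideanSpace ℝ (Fin 3)) '' ↑fccSlots =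
        ((((ℝ ∙ EuclideanSpace.single (2 : Fin 3) (1 : ℝ)).reflection).trans L :
          EuclideanSpace ℝ (Fin 3) ≃ₗᵢ[ℝ] EuclideanSpace ℝ (Fin 3)) :
            EuclideanSpace ℝ (Fin 3) → EuclideanSpace ℝ (Fin 3)) '' ↑fccSlots) := by
  set e₃ : EuclideanSpace ℝ (Fin 3) := EuclideanSpace.single (2 : Fin 3) (1 : ℝ) with he₃
  set L₂ : EuclideanSpace ℝ (Fin 3) ≃ₗᵢ[ℝ] EuclideanSpace ℝ (Fin 3) := ((ℝ ∙ e₃).reflection).trans L with hL₂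
  set K : EuclideanSpace ℝ (Fin 3) := L e₃ with hK
  have hK1 : ‖K‖ = 1 := by rw [hK, LinearIsometryEquiv.norm_map, he₃, PiLp.norm_single, norm_one]
  set G' : EuclideanSpace ℝ (Fin 3) ≃ₗᵢ[ℝ] EuclideanSpace ℝ (Fin 3) := G.trans (ℝ ∙ m)ᗮ.reflection with hG'
  have hG'app : ∀ x, G' x = G x - (2 * ⟪G x, m⟫_ℝ) • m := fun x => by
    rw [hG', LinearIsometryEquiv.trans_apply, reflection_unit_apply hm]
  have hr : 0 < Real.sqrt (2 / 3) := Real.sqrt_pos.2 (by norm_num)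
  have hneg : ∀ {w : EuclideanSpace ℝ (Fin 3)}, w ∈ fccSlots → ⟪G w, m⟫_ℝ < 0 → ⟪G w, m⟫_ℝ = -Real.sqrt (2 / 3) := by
    intro w hw hlt
    rcases hmenu w hw with h | h | h
    · linarith
    · linarith
    · exact h
  -- three distinct lower slots, pairwise at 60°
  have hmenu' : ∀ v ∈ fccSlots, ⟪G v, -m⟫_ℝ = 0 ∨ ⟪G v, -m⟫_ℝ = Real.sqrt (2 / 3) ∨ ⟪G v, -m⟫_ℝ = -Real.sqrt (2 / 3) := by
    intro v hv
    rcases hmenu v hv with h | h | h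
    · left; rw [inner_neg_right, h, neg_zero]
    · right; right; rw [inner_neg_right, h]
    · right; left; rw [inner_neg_right, h, neg_neg]
  have hm' : ‖-m‖ = 1 := by rw [norm_neg, hm]
  obtain ⟨l₁, hl₁, l₂, hl₂, l₃, hl₃, h12, h13, h23', hn₁, hn₂, hn₃⟩ := exists_three_far_slots G hm' hmenu'
  have hlt₁ : ⟪G l₁, m⟫_ℝ < 0 := by rw [inner_neg_right] at hn₁; linarith
  have hlt₂ : ⟪G l₂, m⟫_ℝ < 0 := by rw [inner_neg_right] at hn₂; linarith
  have hlt₃ : ⟪G l₃, m⟫_ℝ < 0 := by rw [inner_neg_right] at hn₃; linarith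
  have i12 : ⟪l₁, l₂⟫_ℝ = 1 / 2 := inner_eq_half_of_pos_pos G hm' hmenu' hl₁ hl₂ h12
    (by rw [inner_neg_right]; linarith) (by rw [inner_neg_right]; linarith)
  have i13 : ⟪l₁, l₃⟫_ℝ = 1 / 2 := inner_eq_half_of_pos_pos G hm' hmenu' hl₁ hl₃ h13
    (by rw [inner_neg_right]; linarith) (by rw [inner_neg_right]; linarith)
  have i23 : ⟪l₂, l₃⟫_ℝ = 1 / 2 := inner_eq_half_of_pos_pos G hm' hmenu' hl₂ hl₃ h23'
    (by rw [inner_neg_right]; linarith) (by rw [inner_neg_right]; linarith)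
  -- unit edges of the lower face, orthogonal to `m`
  have hedge : ∀ {l l' : EuclideanSpace ℝ (Fin 3)}, l ∈ fccSlots → l' ∈ fccSlots → ⟪l, l'⟫_ℝ = 1 / 2 →
      ⟪G l, m⟫_ℝ < 0 → ⟪G l', m⟫_ℝ < 0 → ‖G l - G l'‖ = 1 ∧ ⟪G l - G l', m⟫_ℝ = 0 := by
    intro l l' hl hl' hll' hlt hlt'
    refine ⟨?_, ?_⟩
    · rw [← map_sub, LinearIsometryEquiv.norm_map, norm_eq_one_of_mem_fccSlots (sub_mem_fccSlots_of_inner_eq_half hl hl' hll')]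
    · rw [inner_sub_left, hneg hl hlt, hneg hl' hlt']; ring
  -- MAIN STEP: in every case of `twin_reading_twoLattice`, the lower-face edges are registered in BOTH lattices
  -- `P La Lb sa sb`: the conclusion shape of `twin_reading_twoLattice` for the ordered pair
  have core : ∀ (La Lb : EuclideanSpace ℝ (Fin 3) ≃ₗᵢ[ℝ] EuclideanSpace ℝ (Fin 3)) (sa sb : EuclideanSpace ℝ (Fin 3)),
      (∀ x ∈ X, x ∈ (fun p => La p + sa) '' fccStacking 1 (Real.sqrt (2 / 3)) ∨
        x ∈ (fun p => Lb p + sb) '' fccStacking 1 (Real.sqrt (2 / 3))) →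
      q ∈ (fun p => La p + sa) '' fccStacking 1 (Real.sqrt (2 / 3)) →
      -- edges registered in both, and the frame alternative
      (∀ {l l' : EuclideanSpace ℝ (Fin 3)}, l ∈ fccSlots → l' ∈ fccSlots → ⟪G l, m⟫_ℝ < 0 → ⟪G l', m⟫_ℝ < 0 →
          La.symm (G l - G l') ∈ fccStacking 1 (Real.sqrt (2 / 3)) ∧ Lb.symm (G l - G l') ∈ fccStacking 1 (Real.sqrt (2 / 3))) ∧
      ((G : EuclideanSpace ℝ (Fin 3) → EuclideanSpace ℝ (Fin 3)) '' ↑fccSlots =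
          (La : EuclideanSpace ℝ (Fin 3) → EuclideanSpace ℝ (Fin 3)) '' ↑fccSlots ∨
        (G' : EuclideanSpace ℝ (Fin 3) → EuclideanSpace ℝ (Fin 3)) '' ↑fccSlots =
          (La : EuclideanSpace ℝ (Fin 3) → EuclideanSpace ℝ (Fin 3)) '' ↑fccSlots) := by
    intro La Lb sa sb hX' hq'
    have ed : ∀ l l' : EuclideanSpace ℝ (Fin 3), q + G l - (q + G l') = G l - G l' := fun l l' => by abel
    have eu : ∀ {l l' : EuclideanSpace ℝ (Fin 3)}, l ∈ fccSlots → l' ∈ fccSlots → ⟪G l, m⟫_ℝ < 0 → ⟪G l', m⟫_ℝ < 0 →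
        q + (G l - (2 * ⟪G l, m⟫_ℝ) • m) - (q + (G l' - (2 * ⟪G l', m⟫_ℝ) • m)) = G l - G l' := by
      intro l l' hl hl' hlt hlt'; rw [hneg hl hlt, hneg hl' hlt']; abel
    rcases twin_reading_twoLattice La Lb sa sb hX' G hm hmenu hq' hown hmir with ⟨hfr, hs⟩ | ⟨hfr, hs⟩
    · refine ⟨?_, Or.inl hfr⟩
      intro l l' hl hl' hlt hlt'
      refine ⟨?_, ?_⟩
      · have h := movedFcc_sub_symm_mem La sa (hs _ hl hlt).1 (hs _ hl' hlt').1
        rwa [ed] at h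
      · have h := movedFcc_sub_symm_mem Lb sb (hs _ hl hlt).2.2.1 (hs _ hl' hlt').2.2.1
        rwa [eu hl hl' hlt hlt'] at h
    · refine ⟨?_, Or.inr hfr⟩
      intro l l' hl hl' hlt hlt'
      refine ⟨?_, ?_⟩
      · have h := movedFcc_sub_symm_mem La sa (hs _ hl hlt).2.2.1 (hs _ hl' hlt').2.2.1
        rwa [eu hl hl' hlt hlt'] at h
      · have h := movedFcc_sub_symm_mem Lb sb (hs _ hl hlt).1 (hs _ hl' hlt').1
        rwa [ed] at h
  -- from «edges in both lattices» to `m = ±K`, given the frame alternative relative to SOME frame `F` with axis menu `K`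
  have level : (∀ {l l' : EuclideanSpace ℝ (Fin 3)}, l ∈ fccSlots → l' ∈ fccSlots → ⟪G l, m⟫_ℝ < 0 → ⟪G l', m⟫_ℝ < 0 →
        L.symm (G l - G l') ∈ fccStacking 1 (Real.sqrt (2 / 3)) ∧ L₂.symm (G l - G l') ∈ fccStacking 1 (Real.sqrt (2 / 3))) →
      ∀ (F : EuclideanSpace ℝ (Fin 3) ≃ₗᵢ[ℝ] EuclideanSpace ℝ (Fin 3)),
      (∀ w ∈ fccSlots, ⟪F w, K⟫_ℝ = 0 ∨ ⟪F w, K⟫_ℝ = Real.sqrt (2 / 3) ∨ ⟪F w, K⟫_ℝ = -Real.sqrt (2 / 3)) →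
      ((G : EuclideanSpace ℝ (Fin 3) → EuclideanSpace ℝ (Fin 3)) '' ↑fccSlots =
          (F : EuclideanSpace ℝ (Fin 3) → EuclideanSpace ℝ (Fin 3)) '' ↑fccSlots ∨
        (G' : EuclideanSpace ℝ (Fin 3) → EuclideanSpace ℝ (Fin 3)) '' ↑fccSlots =
          (F : EuclideanSpace ℝ (Fin 3) → EuclideanSpace ℝ (Fin 3)) '' ↑fccSlots) →
      m = K ∨ m = -K := by
    intro hboth F hFmenu hfr
    -- the K-components of the edges vanish
    have h0 : ∀ {l l' : EuclideanSpace ℝ (Fin 3)}, l ∈ fccSlots → l' ∈ fccSlots → ⟪l, l'⟫_ℝ = 1 / 2 →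
        ⟪G l, m⟫_ℝ < 0 → ⟪G l', m⟫_ℝ < 0 → ⟪G l, K⟫_ℝ = ⟪G l', K⟫_ℝ := by
      intro l l' hl hl' hll' hlt hlt'
      obtain ⟨h1, h2⟩ := hboth hl hl' hlt hlt'
      have := unit_orth_axis_of_both L (hedge hl hl' hll' hlt hlt').1 h1 h2
      rw [inner_sub_left] at this; linarith
    rcases hfr with hfr | hfr
    · -- `G` has `F`'s slots: `K` is a menu normal of `G`; cappers `G lₖ` for the normal `−m`
      have hGK := menu_of_image_fccSlots_eq hfr hFmenu
      have hτ := hGK l₁ hl₁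
      rcases eq_or_eq_neg_of_cappers_level (z := K) (n := -m)
          (by rw [LinearIsometryEquiv.norm_map, norm_eq_one_of_mem_fccSlots hl₁])
          (by rw [LinearIsometryEquiv.norm_map, norm_eq_one_of_mem_fccSlots hl₂])
          (by rw [LinearIsometryEquiv.norm_map, norm_eq_one_of_mem_fccSlots hl₃]) hm' hK1
          (by rw [LinearIsometryEquiv.inner_map_map]; exact i12)
          (by rw [LinearIsometryEquiv.inner_map_map]; exact i13)
          (by rw [LinearIsometryEquiv.inner_map_map]; exact i23) hn₁ hn₂ hn₃ hτ rfl
          (h0 hl₁ hl₂ i12 hlt₁ hlt₂).symm (h0 hl₁ hl₃ i13 hlt₁ hlt₃).symm with h | h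
      · right; rw [h, neg_neg]
      · left; rw [h, neg_neg]
    · -- `G'` has `F`'s slots: cappers `G' lₖ` for the normal `m`; the edges of `G'` are those of `G`
      have hGK := menu_of_image_fccSlots_eq hfr hFmenu
      have hG'edge : ∀ {l l' : EuclideanSpace ℝ (Fin 3)}, l ∈ fccSlots → l' ∈ fccSlots →
          ⟪G l, m⟫_ℝ < 0 → ⟪G l', m⟫_ℝ < 0 → G' l - G' l' = G l - G l' := by
        intro l l' hl hl' hlt hlt'
        rw [hG'app, hG'app, hneg hl hlt, hneg hl' hlt']; module
      have h0' : ∀ {l l' : EuclideanSpace ℝ (Fin 3)}, l ∈ fccSlots → l' ∈ fccSlots → ⟪l, l'⟫_ℝ = 1 / 2 →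
          ⟪G l, m⟫_ℝ < 0 → ⟪G l', m⟫_ℝ < 0 → ⟪G' l, K⟫_ℝ = ⟪G' l', K⟫_ℝ := by
        intro l l' hl hl' hll' hlt hlt'
        have := h0 hl hl' hll' hlt hlt'
        have e := hG'edge hl hl' hlt hlt'
        have : ⟪G' l - G' l', K⟫_ℝ = 0 := by rw [e, inner_sub_left]; linarith
        rw [inner_sub_left] at this; linarith
      have hcap : ∀ {l : EuclideanSpace ℝ (Fin 3)}, l ∈ fccSlots → ⟪G l, m⟫_ℝ < 0 → ⟪G' l, m⟫_ℝ = Real.sqrt (2 / 3) := by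
        intro l hl hlt
        rw [hG'app, inner_sub_left, real_inner_smul_left, real_inner_self_eq_norm_sq, hm, hneg hl hlt]; ring
      have hτ := hGK l₁ hl₁
      rcases eq_or_eq_neg_of_cappers_level (z := K) (n := m)
          (by rw [LinearIsometryEquiv.norm_map, norm_eq_one_of_mem_fccSlots hl₁])
          (by rw [LinearIsometryEquiv.norm_map, norm_eq_one_of_mem_fccSlots hl₂])
          (by rw [LinearIsometryEquiv.norm_map, norm_eq_one_of_mem_fccSlots hl₃]) hm hK1
          (by rw [LinearIsometryEquiv.inner_map_map]; exact i12)
          (by rw [LinearIsometryEquiv.inner_map_map]; exact i13)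
          (by rw [LinearIsometryEquiv.inner_map_map]; exact i23) (hcap hl₁ hlt₁) (hcap hl₂ hlt₂) (hcap hl₃ hlt₃) hτ rfl
          (h0' hl₁ hl₂ i12 hlt₁ hlt₂).symm (h0' hl₁ hl₃ i13 hlt₁ hlt₃).symm with h | h
      · left; exact h.symm
      · right; rw [h, neg_neg]
  -- the frame alternative `G'·slots = La·slots` with `m = ±K` becomes `G·slots = (other plate)·slots`
  have flip₁ : (m = K ∨ m = -K) →
      (G' : EuclideanSpace ℝ (Fin 3) → EuclideanSpace ℝ (Fin 3)) '' ↑fccSlots =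
        (L : EuclideanSpace ℝ (Fin 3) → EuclideanSpace ℝ (Fin 3)) '' ↑fccSlots →
      (G : EuclideanSpace ℝ (Fin 3) → EuclideanSpace ℝ (Fin 3)) '' ↑fccSlots =
        (L₂ : EuclideanSpace ℝ (Fin 3) → EuclideanSpace ℝ (Fin 3)) '' ↑fccSlots := by
    intro hmK hfr
    obtain ⟨a, ha, b, hb, c, hc, hab, hac, hbc⟩ := exists_model_face
    have reg : ∀ {w : EuclideanSpace ℝ (Fin 3)}, w ∈ fccSlots → L₂.symm (G w) ∈ fccStacking 1 (Real.sqrt (2 / 3)) := by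
      intro w hw
      obtain ⟨w', hw', hww'⟩ : G' w ∈ (L : EuclideanSpace ℝ (Fin 3) → EuclideanSpace ℝ (Fin 3)) '' ↑fccSlots :=
        hfr ▸ ⟨w, Finset.mem_coe.2 hw, rfl⟩
      have e : G w = (ℝ ∙ m)ᗮ.reflection (L w') := by
        rw [hww', hG', LinearIsometryEquiv.trans_apply, Submodule.reflection_reflection]
      rw [e]; exact symm_twinFrame_reflect_frame L hmK hm (Finset.mem_coe.1 hw')
    exact image_fccSlots_eq_of_face_mem G L₂ ha hb hc hab hac hbc (reg ha) (reg hb) (reg hc)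
  have flip₂ : (m = K ∨ m = -K) →
      (G' : EuclideanSpace ℝ (Fin 3) → EuclideanSpace ℝ (Fin 3)) '' ↑fccSlots =
        (L₂ : EuclideanSpace ℝ (Fin 3) → EuclideanSpace ℝ (Fin 3)) '' ↑fccSlots →
      (G : EuclideanSpace ℝ (Fin 3) → EuclideanSpace ℝ (Fin 3)) '' ↑fccSlots =
        (L : EuclideanSpace ℝ (Fin 3) → EuclideanSpace ℝ (Fin 3)) '' ↑fccSlots := by
    intro hmK hfr
    obtain ⟨a, ha, b, hb, c, hc, hab, hac, hbc⟩ := exists_model_face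
    have reg : ∀ {w : EuclideanSpace ℝ (Fin 3)}, w ∈ fccSlots → L.symm (G w) ∈ fccStacking 1 (Real.sqrt (2 / 3)) := by
      intro w hw
      obtain ⟨w', hw', hww'⟩ : G' w ∈ (L₂ : EuclideanSpace ℝ (Fin 3) → EuclideanSpace ℝ (Fin 3)) '' ↑fccSlots :=
        hfr ▸ ⟨w, Finset.mem_coe.2 hw, rfl⟩
      have e : G w = (ℝ ∙ m)ᗮ.reflection (L₂ w') := by
        rw [hww', hG', LinearIsometryEquiv.trans_apply, Submodule.reflection_reflection]
      rw [e]; exact symm_frame_reflect_twinFrame L hmK hm (Finset.mem_coe.1 hw')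
    exact image_fccSlots_eq_of_face_mem G L ha hb hc hab hac hbc (reg ha) (reg hb) (reg hc)
  -- assemble
  rcases hX q hq with hq₁ | hq₂
  · obtain ⟨hboth, hfr⟩ := core L L₂ s₁ s₂ hX hq₁
    have hmK := level hboth L (menu_axis_frame L) hfr
    refine ⟨hmK, ?_⟩
    rcases hfr with hfr | hfr
    · exact Or.inl hfr
    · exact Or.inr (flip₁ hmK hfr)
  · have hX' : ∀ x ∈ X, x ∈ (fun p => L₂ p + s₂) '' fccStacking 1 (Real.sqrt (2 / 3)) ∨
        x ∈ (fun p => L p + s₁) '' fccStacking 1 (Real.sqrt (2 / 3)) := fun x hx => (hX x hx).symm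
    obtain ⟨hboth, hfr⟩ := core L₂ L s₂ s₁ hX' hq₂
    have hmK := level (fun hl hl' hlt hlt' => ⟨(hboth hl hl' hlt hlt').2, (hboth hl hl' hlt hlt').1⟩) L₂
      (menu_axis_twinFrame L) hfr
    refine ⟨hmK, ?_⟩
    rcases hfr with hfr | hfr
    · exact Or.inr hfr
    · exact Or.inl (flip₂ hmK hfr)

end TwinPlates

end Summit.Ventures.Crystal3D.Theorems

end
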